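import Literature.Computability.AlgebraicComplexity.TableauEvalLabelMajorSymm
import HarnessLib

/-!
# Input splitting of the label-major layers: `layerSum ∘ layersS` (and `∘ layersA`) is ADDITIVE in the input layer

Glue file (cell `val-lit`, DIP20 lane, unit val-lit-t07 g5; theorems only, no definitions, no named
facts) for the Lean checker of tableau highest-weight-vector certificates (`TableauEvalLabelMajor.lean`,
`ChowPointLabelMajorCertificates.lean`, `TableauEvalLabelMajorSymm.lean`).

The certificates of record for Dörfler–Ikenmeyer–Panova's Prop. 5.1, `Ch_4^7` half (arXiv:1901.04576,
Prop. 18 of the e-print) replay the label-major dynamic programme in the kernel in CHUNKS of consecutive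
labels glued through literal intermediate layers (`evalTS_eq_layerSum_split`, `layersS_append`). That
leaves two obstructions: a single label whose expansion is too large for one kernel evaluation, and an
intermediate layer too large to be written as a literal. Both disappear with the observation proved here
([folklore]; it is the linearity of the transfer-matrix method): the meaning of a layer
(`layerSpec`, `TableauEvalLabelMajorImpl.lean` §4) is a SUM over its entries, hence the value computed
from a concatenated input layer is the sum of the values computed from the pieces
(`layerSum_layersS_inputs_append`, `layerSum_layersS_inputs_flatten`; the same for the plain programme,
`layerSum_layersA_inputs_append`, `layerSum_layersA_inputs_flatten`). Consequently a certificate may cut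
ONE literal layer (after any label `k`) into arbitrary consecutive pieces and replay the remaining labels
on every piece independently — in as many kernel evaluations, and files, as needed — the row's value being
the sum of the piece values (`evalTS_eq_sum_pieces`, `evalT_eq_sum_pieces`); and re-merging the pieces' outputs
(key-sorting and compressing a layer, the programme's own merge step) does not change the value either
(`layerSum_layersS_inputs_remerge`, `layerSum_layersA_inputs_remerge`), so after a split label the later
labels continue from ONE merged literal layer and no work is duplicated. The pieces' downstream layers
overlap, so the total work grows, mildly (measured `× 1.04–1.2` for 2–4 pieces on the residue rows of the
cell); what is gained is that no single kernel evaluation and no single literal is large.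

HONEST FRAMING: certificate-checking plumbing for DIP's TOY MODEL `Pow ⊄ Ch` (Chow variety versus power
sums, a KNOWN separation); nothing here bears on permanent versus determinant; VP ≠ VNP is not proved.

## References
* [DorflerIkenmeyerPanova2020] J. Dörfler, C. Ikenmeyer, G. Panova, *On geometric complexity theory:
  multiplicity obstructions are stronger than occurrence obstructions*, SIAM J. Appl. Algebra Geom. 4
  (2020) = arXiv:1901.04576, §5 (proof of Prop. 5.1 = Prop. 18 of the e-print: the proper-placement
  sum and its transfer-matrix organisation, arXiv pp. 12–13).

## Mathlib and tree
Mathlib: `List.sum_append`, `List.map_append`, `List.flatten`, `List.forall_mem_append`.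
Tree: `layersS`, `layerSum_layersS`, `find_tableTrie_perm`, `evalTS`, `evalTS_eq_layerSum_split`
(`TableauEvalLabelMajorSymm`, val-lit-t07 g4); `layersA`, `layerSum`, `Network.initLayer`
(`TableauEvalLabelMajor`); `layerSpec`, `layerSum_layersA`, `pairwise_of_columnStrict`
(`TableauEvalLabelMajorImpl`); `tableTrie`, `evalT`, `evalT_eq_layerSum_split`
(`ChowPointLabelMajorCertificates`, val-lit-t15 g4).
-/

namespace Literature.Computability.AlgebraicComplexity

namespace TableauEval

variable {R : Type*} [CommRing R] [DecidableEq R]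

/-! ## §1 Additivity of the symmetrised programme in its input layer -/

/-- **`layerSum ∘ layersS` is additive in the input layer** (table trie, column-strict network): the
value of the remaining labels `u, …, u+n-1` on a concatenated layer is the sum of the values on the
pieces. [cite: DorflerIkenmeyerPanova2020, §5 (the dynamic programme, arXiv p. 13)] -/
theorem layerSum_layersS_inputs_append (tab : List (List ℕ × R)) (Nw : Network)
    (hcs : Nw.columnStrict = true) (u n : ℕ) (L₁ L₂ : List (ℕ × List (List ℕ) × R))
    (h₁ : ∀ e ∈ L₁, e.2.1.length = Nw.cols.length) (h₂ : ∀ e ∈ L₂, e.2.1.length = Nw.cols.length) :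
    layerSum (layersS Nw.cols Nw.varBound (tableTrie Nw.varBound tab Nw.perLabel [])
        (List.range' u n) (L₁ ++ L₂)) =
      layerSum (layersS Nw.cols Nw.varBound (tableTrie Nw.varBound tab Nw.perLabel [])
          (List.range' u n) L₁) +
        layerSum (layersS Nw.cols Nw.varBound (tableTrie Nw.varBound tab Nw.perLabel [])
          (List.range' u n) L₂) := by
  have hT : ∀ w w' : List ℕ, w.Perm w' →
      (tableTrie Nw.varBound tab Nw.perLabel []).find w = (tableTrie Nw.varBound tab Nw.perLabel []).find w' :=
    fun w w' h => find_tableTrie_perm _ _ _ h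
  have hcs' := pairwise_of_columnStrict Nw hcs
  have h12 : ∀ e ∈ L₁ ++ L₂, e.2.1.length = Nw.cols.length := by
    intro e he
    rcases List.mem_append.mp he with he | he
    · exact h₁ e he
    · exact h₂ e he
  rw [layerSum_layersS Nw.varBound _ hT Nw.cols hcs' n u _ h12,
    layerSum_layersS Nw.varBound _ hT Nw.cols hcs' n u _ h₁,
    layerSum_layersS Nw.varBound _ hT Nw.cols hcs' n u _ h₂]
  unfold layerSpec
  rw [List.map_append, List.sum_append]

/-- **Pieces**: the value on a concatenation of pieces is the sum of the piece values (symmetrised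
programme). [cite: DorflerIkenmeyerPanova2020, §5 (the dynamic programme, arXiv p. 13)] -/
theorem layerSum_layersS_inputs_flatten (tab : List (List ℕ × R)) (Nw : Network)
    (hcs : Nw.columnStrict = true) (u n : ℕ) :
    ∀ (pieces : List (List (ℕ × List (List ℕ) × R))),
      (∀ Q ∈ pieces, ∀ e ∈ Q, e.2.1.length = Nw.cols.length) →
      layerSum (layersS Nw.cols Nw.varBound (tableTrie Nw.varBound tab Nw.perLabel [])
          (List.range' u n) pieces.flatten) =
        (pieces.map fun Q => layerSum (layersS Nw.cols Nw.varBound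
          (tableTrie Nw.varBound tab Nw.perLabel []) (List.range' u n) Q)).sum
  | [], _ => by
    simp [layersS_range'_nil_input, layerSum]
  | Q :: pieces, h => by
    have hQ : ∀ e ∈ Q, e.2.1.length = Nw.cols.length := h Q (by simp)
    have hrest : ∀ Q' ∈ pieces, ∀ e ∈ Q', e.2.1.length = Nw.cols.length :=
      fun Q' hQ' => h Q' (by simp [hQ'])
    have hflat : ∀ e ∈ pieces.flatten, e.2.1.length = Nw.cols.length := by
      intro e he
      obtain ⟨Q', hQ', he'⟩ := List.mem_flatten.mp he
      exact hrest Q' hQ' e he'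
    rw [List.flatten_cons, layerSum_layersS_inputs_append tab Nw hcs u n Q _ hQ hflat,
      layerSum_layersS_inputs_flatten tab Nw hcs u n pieces hrest, List.map_cons, List.sum_cons]
where
  /-- on the empty input layer every run of labels returns the empty layer -/
  layersS_range'_nil_input : ∀ (us : List ℕ),
      layersS Nw.cols Nw.varBound (tableTrie Nw.varBound tab Nw.perLabel []) us
        ([] : List (ℕ × List (List ℕ) × R)) = [] := by
    intro us
    induction us with
    | nil => rfl
    | cons u us ih =>
      rw [layersS]
      have : stepS Nw.cols Nw.varBound (tableTrie Nw.varBound tab Nw.perLabel []) u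
          ([] : List (ℕ × List (List ℕ) × R)) = [] := by
        simp [stepS, stepA, expandA, compressA, msortK]
      rw [this, ih]

/-- **The value of a certificate as a sum over pieces of one literal layer** (symmetrised programme):
if the layers of the labels `0, …, k-1` from the initial layer are the concatenation of `pieces`, then
`evalTS` is the sum over the pieces of the values of the labels `k, …, d-1` replayed on each piece.
[cite: DorflerIkenmeyerPanova2020, §5 (proof of Prop. 5.1, arXiv pp. 12–13)] -/
theorem evalTS_eq_sum_pieces (tab : List (List ℕ × R)) (Nw : Network) (hcs : Nw.columnStrict = true)
    (k : ℕ) (hk : k ≤ Nw.nlabels) (pieces : List (List (ℕ × List (List ℕ) × R)))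
    (hB : layersS Nw.cols Nw.varBound (tableTrie Nw.varBound tab Nw.perLabel [])
        (List.range' 0 k) Nw.initLayer = pieces.flatten)
    (hlen : ∀ Q ∈ pieces, ∀ e ∈ Q, e.2.1.length = Nw.cols.length) :
    evalTS tab Nw = (pieces.map fun Q => layerSum (layersS Nw.cols Nw.varBound
      (tableTrie Nw.varBound tab Nw.perLabel []) (List.range' k (Nw.nlabels - k)) Q)).sum := by
  rw [evalTS_eq_layerSum_split tab Nw k hk, hB]
  exact layerSum_layersS_inputs_flatten tab Nw hcs k (Nw.nlabels - k) pieces hlen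

/-! ## §2 The same for the plain programme `layersA` / `evalT` -/

/-- **`layerSum ∘ layersA` is additive in the input layer** (table trie, column-strict network).
[cite: DorflerIkenmeyerPanova2020, §5 (the dynamic programme, arXiv p. 13)] -/
theorem layerSum_layersA_inputs_append (tab : List (List ℕ × R)) (Nw : Network)
    (hcs : Nw.columnStrict = true) (u n : ℕ) (L₁ L₂ : List (ℕ × List (List ℕ) × R))
    (h₁ : ∀ e ∈ L₁, e.2.1.length = Nw.cols.length) (h₂ : ∀ e ∈ L₂, e.2.1.length = Nw.cols.length) :
    layerSum (layersA Nw.cols Nw.varBound (tableTrie Nw.varBound tab Nw.perLabel [])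
        (List.range' u n) (L₁ ++ L₂)) =
      layerSum (layersA Nw.cols Nw.varBound (tableTrie Nw.varBound tab Nw.perLabel [])
          (List.range' u n) L₁) +
        layerSum (layersA Nw.cols Nw.varBound (tableTrie Nw.varBound tab Nw.perLabel [])
          (List.range' u n) L₂) := by
  have hcs' := pairwise_of_columnStrict Nw hcs
  have h12 : ∀ e ∈ L₁ ++ L₂, e.2.1.length = Nw.cols.length := by
    intro e he
    rcases List.mem_append.mp he with he | he
    · exact h₁ e he
    · exact h₂ e he
  rw [layerSum_layersA Nw.varBound _ Nw.cols hcs' n u _ h12,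
    layerSum_layersA Nw.varBound _ Nw.cols hcs' n u _ h₁,
    layerSum_layersA Nw.varBound _ Nw.cols hcs' n u _ h₂]
  unfold layerSpec
  rw [List.map_append, List.sum_append]

/-- **Pieces**, plain programme. [cite: DorflerIkenmeyerPanova2020, §5 (the dynamic programme, arXiv p. 13)] -/
theorem layerSum_layersA_inputs_flatten (tab : List (List ℕ × R)) (Nw : Network)
    (hcs : Nw.columnStrict = true) (u n : ℕ) :
    ∀ (pieces : List (List (ℕ × List (List ℕ) × R))),
      (∀ Q ∈ pieces, ∀ e ∈ Q, e.2.1.length = Nw.cols.length) →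
      layerSum (layersA Nw.cols Nw.varBound (tableTrie Nw.varBound tab Nw.perLabel [])
          (List.range' u n) pieces.flatten) =
        (pieces.map fun Q => layerSum (layersA Nw.cols Nw.varBound
          (tableTrie Nw.varBound tab Nw.perLabel []) (List.range' u n) Q)).sum
  | [], _ => by
    simp [layersA_nil_input, layerSum]
  | Q :: pieces, h => by
    have hQ : ∀ e ∈ Q, e.2.1.length = Nw.cols.length := h Q (by simp)
    have hrest : ∀ Q' ∈ pieces, ∀ e ∈ Q', e.2.1.length = Nw.cols.length :=
      fun Q' hQ' => h Q' (by simp [hQ'])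
    have hflat : ∀ e ∈ pieces.flatten, e.2.1.length = Nw.cols.length := by
      intro e he
      obtain ⟨Q', hQ', he'⟩ := List.mem_flatten.mp he
      exact hrest Q' hQ' e he'
    rw [List.flatten_cons, layerSum_layersA_inputs_append tab Nw hcs u n Q _ hQ hflat,
      layerSum_layersA_inputs_flatten tab Nw hcs u n pieces hrest, List.map_cons, List.sum_cons]
where
  /-- on the empty input layer every run of labels returns the empty layer -/
  layersA_nil_input : ∀ (us : List ℕ),
      layersA Nw.cols Nw.varBound (tableTrie Nw.varBound tab Nw.perLabel []) us
        ([] : List (ℕ × List (List ℕ) × R)) = [] := by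
    intro us
    induction us with
    | nil => rfl
    | cons u us ih =>
      rw [layersA]
      have : stepA Nw.cols Nw.varBound (tableTrie Nw.varBound tab Nw.perLabel []) u
          ([] : List (ℕ × List (List ℕ) × R)) = [] := by
        simp [stepA, expandA, compressA, msortK]
      rw [this, ih]

/-- **The value of a certificate as a sum over pieces of one literal layer** (plain programme).
[cite: DorflerIkenmeyerPanova2020, §5 (proof of Prop. 5.1, arXiv pp. 12–13)] -/
theorem evalT_eq_sum_pieces (tab : List (List ℕ × R)) (Nw : Network) (hcs : Nw.columnStrict = true)
    (k : ℕ) (hk : k ≤ Nw.nlabels) (pieces : List (List (ℕ × List (List ℕ) × R)))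
    (hB : layersA Nw.cols Nw.varBound (tableTrie Nw.varBound tab Nw.perLabel [])
        (List.range' 0 k) Nw.initLayer = pieces.flatten)
    (hlen : ∀ Q ∈ pieces, ∀ e ∈ Q, e.2.1.length = Nw.cols.length) :
    evalT tab Nw = (pieces.map fun Q => layerSum (layersA Nw.cols Nw.varBound
      (tableTrie Nw.varBound tab Nw.perLabel []) (List.range' k (Nw.nlabels - k)) Q)).sum := by
  rw [evalT_eq_layerSum_split tab Nw k hk, hB]
  exact layerSum_layersA_inputs_flatten tab Nw hcs k (Nw.nlabels - k) pieces hlen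

/-! ## §2b Re-merging pieces: sorting and compressing an input layer does not change the value -/

/-- **Re-merging is invisible to the value** (symmetrised programme): replacing an input layer by its
key-sorted, compressed form (`compressA (msortK fuel L)`, the merge step of the programme itself) leaves
`layerSum ∘ layersS` unchanged — so the outputs of the pieces of a split label may be concatenated and
re-merged into the ONE literal layer from which the later labels continue. The merged layer is given
explicitly (`hM`), so that both length side conditions are decidable on literals.
[cite: DorflerIkenmeyerPanova2020, §5 (the dynamic programme, arXiv p. 13)] -/
theorem layerSum_layersS_inputs_remerge (tab : List (List ℕ × R)) (Nw : Network)
    (hcs : Nw.columnStrict = true) (u n fuel : ℕ) (L Mg : List (ℕ × List (List ℕ) × R))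
    (hM : compressA (msortK fuel L) = Mg)
    (hL : ∀ e ∈ L, e.2.1.length = Nw.cols.length) (hMl : ∀ e ∈ Mg, e.2.1.length = Nw.cols.length) :
    layerSum (layersS Nw.cols Nw.varBound (tableTrie Nw.varBound tab Nw.perLabel [])
        (List.range' u n) Mg) =
      layerSum (layersS Nw.cols Nw.varBound (tableTrie Nw.varBound tab Nw.perLabel [])
        (List.range' u n) L) := by
  have hT : ∀ w w' : List ℕ, w.Perm w' →
      (tableTrie Nw.varBound tab Nw.perLabel []).find w = (tableTrie Nw.varBound tab Nw.perLabel []).find w' :=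
    fun w w' h => find_tableTrie_perm _ _ _ h
  have hcs' := pairwise_of_columnStrict Nw hcs
  rw [layerSum_layersS Nw.varBound _ hT Nw.cols hcs' n u _ hMl,
    layerSum_layersS Nw.varBound _ hT Nw.cols hcs' n u _ hL, ← hM]
  unfold layerSpec
  refine Eq.trans (sum_compressA (fun st => specL
    (fun w => (tableTrie Nw.varBound tab Nw.perLabel []).find w) (List.range' u n) (resid Nw.cols st u))
    (msortK fuel L)) ?_
  exact ((msortK_perm fuel L).map _).sum_eq

/-- **Re-merging is invisible to the value** (plain programme). [cite: DorflerIkenmeyerPanova2020, §5 (the dynamic programme, arXiv p. 13)] -/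
theorem layerSum_layersA_inputs_remerge (tab : List (List ℕ × R)) (Nw : Network)
    (hcs : Nw.columnStrict = true) (u n fuel : ℕ) (L Mg : List (ℕ × List (List ℕ) × R))
    (hM : compressA (msortK fuel L) = Mg)
    (hL : ∀ e ∈ L, e.2.1.length = Nw.cols.length) (hMl : ∀ e ∈ Mg, e.2.1.length = Nw.cols.length) :
    layerSum (layersA Nw.cols Nw.varBound (tableTrie Nw.varBound tab Nw.perLabel [])
        (List.range' u n) Mg) =
      layerSum (layersA Nw.cols Nw.varBound (tableTrie Nw.varBound tab Nw.perLabel [])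
        (List.range' u n) L) := by
  have hcs' := pairwise_of_columnStrict Nw hcs
  rw [layerSum_layersA Nw.varBound _ Nw.cols hcs' n u _ hMl,
    layerSum_layersA Nw.varBound _ Nw.cols hcs' n u _ hL, ← hM]
  unfold layerSpec
  refine Eq.trans (sum_compressA (fun st => specL
    (fun w => (tableTrie Nw.varBound tab Nw.perLabel []).find w) (List.range' u n) (resid Nw.cols st u))
    (msortK fuel L)) ?_
  exact ((msortK_perm fuel L).map _).sum_eq

/-- The toy network, plain programme: re-merging the two one-state pieces' outputs of label `1` (each
the single state `(0, [[],[]], -1)`) gives the merged final layer `[(0, [[],[]], -2)]`. [folklore] -/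
example :
    compressA (msortK 3 ([((0 : ℕ), ([[], []] : List (List ℕ)), (-1 : ℤ))] ++ [(0, [[], []], -1)])) =
      [(0, [[], []], -2)] := by
  decide +kernel

/-! ## §3 Sanity values (kernel) -/

/-- On the toy network `0 0 / 1 1` at `x₀x₁` (table `[([1,1], 1)]`), plain programme: the literal
layer after label `0` has the two states `(6, [[1],[0]], -1)` and `(9, [[0],[1]], -1)`; replaying label
`1` on each one-state piece gives `-1` and `-1`, and `evalT = -2 = -1 + -1`. [folklore] -/
example :
    let Nw : Network := ⟨2, 2, [⟨[0, 1], [0, 1]⟩, ⟨[0, 1], [0, 1]⟩]⟩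
    let tab : List (List ℕ × ℤ) := [([1, 1], 1)]
    evalT tab Nw = -2 ∧
    layersA Nw.cols Nw.varBound (tableTrie Nw.varBound tab Nw.perLabel []) (List.range' 0 1) Nw.initLayer =
      [(6, [[1], [0]], -1)] ++ [(9, [[0], [1]], -1)] ∧
    layerSum (layersA Nw.cols Nw.varBound (tableTrie Nw.varBound tab Nw.perLabel []) (List.range' 1 1)
      [(6, [[1], [0]], -1)]) = -1 ∧
    layerSum (layersA Nw.cols Nw.varBound (tableTrie Nw.varBound tab Nw.perLabel []) (List.range' 1 1)
      [(9, [[0], [1]], -1)]) = -1 := by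
  decide +kernel

/-- The same toy network with the symmetrised programme: the two columns are equal, so the literal
layer after label `0` is the single canonical state `(9, [[0],[1]], -2)`, and `evalTS = -2`.
[folklore] -/
example :
    let Nw : Network := ⟨2, 2, [⟨[0, 1], [0, 1]⟩, ⟨[0, 1], [0, 1]⟩]⟩
    let tab : List (List ℕ × ℤ) := [([1, 1], 1)]
    evalTS tab Nw = -2 ∧
    layersS Nw.cols Nw.varBound (tableTrie Nw.varBound tab Nw.perLabel []) (List.range' 0 1) Nw.initLayer =
      [(9, [[0], [1]], -2)] ∧
    layerSum (layersS Nw.cols Nw.varBound (tableTrie Nw.varBound tab Nw.perLabel []) (List.range' 1 1)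
      [(9, [[0], [1]], -2)]) = -2 := by
  decide +kernel

end TableauEval

end Literature.Computability.AlgebraicComplexity
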